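import Literature.MathematicalPhysics.QuantumFieldTheory.Balaban1983to89.B9Eq3132FromStateR

/-!
# `Balaban1983to89.B9Eq3132FromStateRJ` — [B9] Thm 3.12 p. 423 ∕ (3.130) p. 421 ∕ (3.138) p. 423 ∕ (3.132) p. 422, [4] (2.51)–(2.54), Lemma 2.1 (2.61): THE FOUR
# FAMILIES OF (2.51) MAJORANTS FROM THE STATE TUPLE AT THE PINS, ALONG A SUB-FAMILY `f : J → MemberY …` — `B9Eq3132FromStateR.majorants4_of_stepS_R` along `f`

T. Bałaban, *Propagators for lattice gauge theories in a background field*, Commun. Math. Phys. **99** (1985) 389–434 [`Balaban1985BackgroundPropagators`]; [4] =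
*Propagators and renormalization transformations for lattice gauge theories. II*, Commun. Math. Phys. **96** (1984) 223–250 [`Balaban1984PropagatorsII`].

statement-level companion of published sources with citation tags; every declaration here is a theorem; nothing here is a claim about the
Yang–Mills mass gap

WHY THIS FILE (cell `pub-ymgap`, seat `dag-n06-l` g41, 2026-08-31; sibling of dag-n06-i's `B9Eq3132FromStateR` §Family, untouched).  The parent asks the STATE TUPLE
`hstate` (the step `StepS`, the producer `G₀ : 𝔠⁽⁰⁾ → 𝔖`, the reading `id : 𝔖 → 𝔠^{(−2)}`, `κ ≤ κ_S`, the ℓ¹-domination, the identities) as a ROW OVER THE WHOLE MEMBER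
FAMILY, although its proof reads it only at the member of the conclusion (per-member atom `hasMajorant_entries_of_stepS` + [4] (2.61) `rowSum261_geo9Y`).  A consumer
whose state tuple lives on a SUB-FAMILY `j ↦ f j` only (IR-N06-SECTION-2 road R1, ★★★ director-ym №524 (3): the N06 producer cone re-keyed along `f : J → MemberY …`,
dag-n06-d `R1-JTWIN-SPEC.md` rule (R)′; here the J-twin of N06's row-26 knit reader `…Eq3132FromStateKnitQ`, word dag-n06-d g30 I.23529 (a)) needs the same theorem with
`hstate : ∀ j : J, … (f j) …` and the four majorant families concluded `∀ j : J, … (f j) …`: ★★ `majorants4_of_stepS_R_J`.  The letters `𝔬 T T₁ T₀ 𝔖 bI H₀` and the pins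
`hblk hGco hG1co hG0co` stay member-wide (read at `f j`); `hgeo` member-wide.  The member-wide parent is the instance `J := MemberY …`, `f := id`.
PROOF: the parent's text by generator (`pub-ymgap-dag-n06-l/lean/g41/gen/mkJ.py`): `fun x ↦ fun j`, member reads `x ↦ f j`, `hstate x ↦ hstate j`; the private `small_aux`
copied verbatim; nothing re-derived.
HONEST SCOPE.  Kernel bookkeeping BY NAME over the parent's per-member atom and [4] (2.61); the state tuple is a HYPOTHESIS; nothing of [B9] ∕ [4] asserted; count-neutral;
N06 NOT discharged; one finite 𝕋^{d+1} programme — nothing continuum ∕ ℝ⁴ ∕ OS ∕ mass gap ∕ Clay.  No `sorry`, no `def`, no `instance`, no `notation`.  Relative not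
restated: the parent (this is its restriction along `f`).
-/

noncomputable section

namespace Literature.MathematicalPhysics.QuantumFieldTheory.Balaban1983to89.B9Eq3132FromStateRJ

open B9Eq3132FromStateR (hasMajorant_entries_of_stepS)

open Node00
open B6RandomWalk (HasMajorant hasMajorant_mono Triangle254)
open B6RandomWalkHom (HasMajorantHom hasMajorantHom_iff)
open B6GlobalChartV1 (blkV1)
open B6Ineq2142KLevelV1 (lvl β)
open B9Thm34Ext (toB6)
open B11SectG (RowSum HasMaj BlockNorm hasMaj_comp_exp)
open B9Thm312Whole (Ops Identities GeoOK cNorm)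
open B9Thm312WholeClasses (cNormR cNormR_loc hasMajorantHom_of_hasMaj_cNormR)
open B9Thm312WholeLeaf (fix_of_inverses)
open B9Thm312WholeStepRegular (StepS hasMaj_right_of_stepS hasMaj_read_of_state exists_hasMaj_const_of_dom)
open B9SectDSup (weightNorm_loc)
open B9PinMembersKLevelV1 (MemberY geo9Y)
open B9BackgroundsKLevelV1R (RegFamY bg9YR regY335 regY336 siteKernelR MemOfFam)
open B7Prop2SpecialUnitary (specialUnitaryUnits specialUnitaryUnits_le_unitaryUnits)
open B9Ineq349SiteFromConv342 (contractive_of_mem)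
open B9CoReadingCoords (XBK blkBK GcoK)
open B9CoReadingCoordsTranspose (TrIdx trBasis)
open B9Thm311ReadingCoords (trIP PosDefTr)
open B9RWSumsReadsNbr (nbr)
open B9GeoLemma21KLevelV1 (rowSum261_geo9Y)
open B9Eq3132RingInverseReading (normMatY)
open B9Eq3132NuReading (lamInvY nuY siteKernelOfOpNu opsYS349NuOfLetters)
open B9Eq3132CTInputs (CoerciveUnder DecayUnder)
open B9Eq3132ScalarIndex (geoComap)
open B9Eq3132StepDifference (GcoK_sub)
open B9Eq3132DecayFromMajorantR (decayUnder_QGQOfY_of_majorants_R)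
open B9Eq3132CoerciveFromGAR (coerciveUnder_of_subMajorants_R)
open B9Eq3132CoerciveFromEnergyR (hcoA_of_refinesY_R)
open B9Eq3132FacesAtLettersR (hdec26_of_majorants_of_R s3132Nu_opsYSectE_of_ringInverse_R)
open scoped Matrix.Norms.L2Operator

section Family

variable {𝔸 : Type} [NormedRing 𝔸] [NormedAlgebra ℂ 𝔸]
variable {κ : Type} [Fintype κ] [DecidableEq κ]
variable {d ℓ : ℕ} {hd : 1 ≤ d + 1} {hL : Odd (ℓ + 1) ∧ 1 < ℓ + 1} {b₀ b₁ : ℝ} {Mstar : ℕ}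
variable [CompleteSpace 𝔸] [FiniteDimensional ℝ 𝔸] {G : Subgroup 𝔸ˣ}
variable (R₁ R₂ : RegFamY d ℓ hd hL b₀ b₁ Mstar 𝔸)
variable {Y Z W : MemberY d ℓ hd hL b₀ b₁ Mstar → Type} [∀ x, Fintype (Z x)] [∀ x, Fintype (W x)]

/-- a small product: `0 ≤ t`, `m ≤ (2(t+1))⁻¹` ⇒ `t·m ≤ ½`. [folklore] -/
private theorem small_aux {t m : ℝ} (ht : 0 ≤ t) (hm : m ≤ (2 * (t + 1))⁻¹) : t * m ≤ 1 / 2 := by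
  have h1 : t * m ≤ t * (2 * (t + 1))⁻¹ := mul_le_mul_of_nonneg_left hm ht
  have h2 : t * (2 * (t + 1))⁻¹ ≤ 1 / 2 := by
    rw [← div_eq_mul_inv, div_le_iff₀ (by positivity)]
    nlinarith
  exact h1.trans h2

omit [DecidableEq κ] in
/-- ★★ **THE FOUR FAMILIES OF (2.51) MAJORANTS FROM THE STATE TUPLE AT THE PINS** — the state-class twin of `B9Eq3132DecayFromMajorantR.majorants_of_step12_R` and
`B9Eq3132CoerciveFromGAR.subMajorants_of_step12_R`: at the coordinate pins (`blk = blkBK bI`, `G ∕ G1 ∕ G0 = GcoK … (T ∕ T₁ ∕ T₀) U`), the STATE TUPLE `hstate` (the step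
`StepS (𝔬 x) (𝔖 x U) (θ_S·Mα₀) δ_K U`, the producer `G₀ : 𝔠⁽⁰⁾ → 𝔖` (A₀e^{−δ_P d}), the reading `id : 𝔖 → 𝔠^{(−2)}` (C_Re^{−δ_P d}), `κ ≦ κ_S`, the ℓ¹-domination, the identities —
conjuncts of the S-leaves' `hstate2`) and [4] (2.61) (`rowSum261_geo9Y`, σ > 0) give, above `max(M₁, M_L)` and for `Mα₀ ≤ min(a₁, (2(κ_Sθ_Sc+1))⁻¹)`, the majorants
`C₁(Lʲη)²e^{−δd}` of the models of `T`, `T₁` and `C₂·(Mα₀)·(Lʲη)²e^{−δd}` of `T − T₀`, `T₁ − T₀` (any 0 < δ with δ + 2σ ≦ δ_K, δ + σ ≦ δ_P).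
[cite: Balaban1985BackgroundPropagators, Thm 3.12 p.423, (3.130) p.421, (3.138) p.423, (3.132) p.422; Balaban1984PropagatorsII, (2.51)–(2.54) pp.232–233, Lemma 2.1 (2.61) p.234] -/
theorem majorants4_of_stepS_R_J [∀ x : MemberY d ℓ hd hL b₀ b₁ Mstar, Fintype (geo9Y x).Site] (bK : Module.Basis κ ℝ 𝔸) {c35 : ℝ}
    (𝔬 : ∀ x : MemberY d ℓ hd hL b₀ b₁ Mstar, Ops (geo9Y x) (bg9YR 𝔸 G R₁ R₂ x) (XBK κ x.toKIdx) (Y x) (Z x) (W x))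
    (H₀ : MemberY d ℓ hd hL b₀ b₁ Mstar → Prop) {J : Type} (f : J → MemberY d ℓ hd hL b₀ b₁ Mstar) (T T₁ T₀ : ∀ x : MemberY d ℓ hd hL b₀ b₁ Mstar, BondOpY 𝔸 x.toKIdx)
    {bI : ∀ x : MemberY d ℓ hd hL b₀ b₁ Mstar, FBondY x.toKIdx → IBondY x.toKIdx}
    (hblk : ∀ x, (𝔬 x).blk = blkBK x.toKIdx (bI x))
    (hGco : ∀ (x : MemberY d ℓ hd hL b₀ b₁ Mstar) (U : (bg9YR 𝔸 G R₁ R₂ x).Cfg), (𝔬 x).G U = GcoK x.toKIdx bK (bg9YR 𝔸 G R₁ R₂ x) (fun U => U) (T x) U)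
    (hG1co : ∀ (x : MemberY d ℓ hd hL b₀ b₁ Mstar) (U : (bg9YR 𝔸 G R₁ R₂ x).Cfg), (𝔬 x).G1 U = GcoK x.toKIdx bK (bg9YR 𝔸 G R₁ R₂ x) (fun U => U) (T₁ x) U)
    (hG0co : ∀ (x : MemberY d ℓ hd hL b₀ b₁ Mstar) (U : (bg9YR 𝔸 G R₁ R₂ x).Cfg), (𝔬 x).G0 U = GcoK x.toKIdx bK (bg9YR 𝔸 G R₁ R₂ x) (fun U => U) (T₀ x) U)
    (𝔖 : ∀ x : MemberY d ℓ hd hL b₀ b₁ Mstar, (bg9YR 𝔸 G R₁ R₂ x).Cfg → BlockNorm (toB6 (geo9Y x) 1 (H₀ x)) (XBK κ x.toKIdx → ℝ))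
    (θS A₀ CR κS δK δP σ δ a₁ M₁ : ℝ) (hθS : 0 ≤ θS) (hA₀ : 0 ≤ A₀) (hCR : 0 ≤ CR) (hκS : 0 ≤ κS) (hσ : 0 < σ) (hδ : 0 < δ) (hδK : δ + 2 * σ ≤ δK) (hδP : δ + σ ≤ δP)
    (ha₁ : 0 < a₁) (hM₁ : 0 < M₁) (hgeo : ∀ x : MemberY d ℓ hd hL b₀ b₁ Mstar, GeoOK (geo9Y x))
    (hstate : ∀ j : J, M₁ ≤ (geo9Y (f j)).M → ∀ α₀ : ℝ, 0 < α₀ → (geo9Y (f j)).M * α₀ ≤ a₁ →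
      ∀ U : (bg9YR 𝔸 G R₁ R₂ (f j)).Cfg, (bg9YR 𝔸 G R₁ R₂ (f j)).Reg335 c35 α₀ U → (bg9YR 𝔸 G R₁ R₂ (f j)).Reg336 c35 α₀ U →
        StepS (𝔬 (f j)) (𝔖 (f j) U) (θS * ((geo9Y (f j)).M * α₀)) δK U ∧
        HasMaj (cNorm 1 (H₀ (f j)) (𝔬 (f j)).blk (hgeo (f j)).lenle 0) (𝔖 (f j) U) ((𝔬 (f j)).G0 U) (fun a b => A₀ * Real.exp (-(δP * (geo9Y (f j)).dist a b))) ∧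
        HasMaj (𝔖 (f j) U) (cNormR 1 (H₀ (f j)) (𝔬 (f j)).blk (hgeo (f j)).lenle (-2)) LinearMap.id (fun a b => CR * Real.exp (-(δP * (geo9Y (f j)).dist a b))) ∧
        (𝔖 (f j) U).κ ≤ κS ∧ (∃ Λ : ℝ, 0 ≤ Λ ∧ ∀ (y : (geo9Y (f j)).Site) (F : XBK κ (f j).toKIdx → ℝ), (𝔖 (f j) U).loc y F ≤ Λ * ∑ q : XBK κ (f j).toKIdx, |F q|) ∧
        Identities (𝔬 (f j)) U) :
    ∃ M₂ a₂ C₁ C₂ : ℝ, 0 < M₂ ∧ 0 < a₂ ∧ 0 ≤ C₁ ∧ 0 ≤ C₂ ∧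
      ∀ j : J, M₂ ≤ (geo9Y (f j)).M → ∀ α₀ : ℝ, 0 < α₀ → (geo9Y (f j)).M * α₀ ≤ a₂ →
        ∀ U : (bg9YR 𝔸 G R₁ R₂ (f j)).Cfg, (bg9YR 𝔸 G R₁ R₂ (f j)).Reg335 c35 α₀ U → (bg9YR 𝔸 G R₁ R₂ (f j)).Reg336 c35 α₀ U →
          HasMajorant (g := toB6 (geo9Y (f j)) 1 (H₀ (f j))) (blkBK (f j).toKIdx (bI (f j))) (GcoK (f j).toKIdx bK (bg9YR 𝔸 G R₁ R₂ (f j)) (fun U => U) (T (f j)) U)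
              (fun a a' => C₁ * (geo9Y (f j)).len a ^ 2 * Real.exp (-(δ * (geo9Y (f j)).dist a a'))) ∧
            HasMajorant (g := toB6 (geo9Y (f j)) 1 (H₀ (f j))) (blkBK (f j).toKIdx (bI (f j))) (GcoK (f j).toKIdx bK (bg9YR 𝔸 G R₁ R₂ (f j)) (fun U => U) (T₁ (f j)) U)
              (fun a a' => C₁ * (geo9Y (f j)).len a ^ 2 * Real.exp (-(δ * (geo9Y (f j)).dist a a'))) ∧
            HasMajorant (g := toB6 (geo9Y (f j)) 1 (H₀ (f j))) (blkBK (f j).toKIdx (bI (f j))) (GcoK (f j).toKIdx bK (bg9YR 𝔸 G R₁ R₂ (f j)) (fun U => U) (T (f j) - T₀ (f j)) U)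
              (fun a a' => C₂ * ((geo9Y (f j)).M * α₀) * (geo9Y (f j)).len a ^ 2 * Real.exp (-(δ * (geo9Y (f j)).dist a a'))) ∧
            HasMajorant (g := toB6 (geo9Y (f j)) 1 (H₀ (f j))) (blkBK (f j).toKIdx (bI (f j))) (GcoK (f j).toKIdx bK (bg9YR 𝔸 G R₁ R₂ (f j)) (fun U => U) (T₁ (f j) - T₀ (f j)) U)
              (fun a a' => C₂ * ((geo9Y (f j)).M * α₀) * (geo9Y (f j)).len a ^ 2 * Real.exp (-(δ * (geo9Y (f j)).dist a a'))) := by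
  -- (2.61) for the record geometry at rate σ, constant `max c 0`
  obtain ⟨ML, c, hrow0⟩ := rowSum261_geo9Y (d := d) (ℓ := ℓ) (hd := hd) (hL := hL) (b₀ := b₀) (b₁ := b₁) (Mstar := Mstar) σ hσ
  set c' : ℝ := max c 0 with hc'
  have hc'0 : 0 ≤ c' := le_max_right _ _
  have hrow : ∀ x : MemberY d ℓ hd hL b₀ b₁ Mstar, ML ≤ (geo9Y x).M → RowSum (toB6 (geo9Y x) 1 (H₀ x)) σ c' :=
    fun x hM y => (hrow0 x hM y).trans (le_max_left _ _)
  set a₂ : ℝ := min a₁ (2 * (κS * θS * c' + 1))⁻¹ with ha₂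
  have ha₂0 : 0 < a₂ := lt_min ha₁ (inv_pos.2 (by positivity))
  refine ⟨max M₁ ML, a₂, 2 * κS * CR * A₀ * c', 2 * κS * κS * CR * A₀ * c' * c' * θS, lt_of_lt_of_le hM₁ (le_max_left _ _), ha₂0, by positivity, by positivity,
    fun j hM α₀ hα₀ hMa U hU hU' => ?_⟩
  have hM1 : M₁ ≤ (geo9Y (f j)).M := (le_max_left _ _).trans hM
  have hMLx : ML ≤ (geo9Y (f j)).M := (le_max_right _ _).trans hM
  have hMa1 : (geo9Y (f j)).M * α₀ ≤ a₁ := hMa.trans (min_le_left _ _)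
  obtain ⟨hS, hP, hRd, hκ, ⟨Λ, hΛ, hdom⟩, hI⟩ := hstate j hM1 α₀ hα₀ hMa1 U hU hU'
  have hMα0 : 0 ≤ (geo9Y (f j)).M * α₀ := mul_nonneg (hM₁.le.trans hM1) hα₀.le
  have hsmall : κS * (θS * ((geo9Y (f j)).M * α₀)) * c' ≤ 1 / 2 := by
    have h := small_aux (t := κS * θS * c') (m := (geo9Y (f j)).M * α₀) (by positivity) (hMa.trans (min_le_right _ _))
    calc κS * (θS * ((geo9Y (f j)).M * α₀)) * c' = κS * θS * c' * ((geo9Y (f j)).M * α₀) := by ring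
      _ ≤ 1 / 2 := h
  obtain ⟨h1, h2, h3, h4⟩ := hasMajorant_entries_of_stepS (hgeo (f j)) (𝔬 (f j)) (hrow (f j) hMLx) (mul_nonneg hθS hMα0) hA₀ hCR hκS hδ.le hδK hδP hσ.le hc'0 hsmall
    hS hP hRd hκ hΛ hdom hI
  rw [hblk (f j)] at h1 h2 h3 h4
  rw [hGco (f j) U] at h1
  rw [hG1co (f j) U] at h2
  rw [hGco (f j) U, hG0co (f j) U, ← GcoK_sub] at h3
  rw [hG1co (f j) U, hG0co (f j) U, ← GcoK_sub] at h4
  have he : ∀ a a' : (geo9Y (f j)).Site, 2 * κS * κS * CR * A₀ * c' * c' * (θS * ((geo9Y (f j)).M * α₀)) * (geo9Y (f j)).len a ^ 2 * Real.exp (-(δ * (geo9Y (f j)).dist a a')) =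
      2 * κS * κS * CR * A₀ * c' * c' * θS * ((geo9Y (f j)).M * α₀) * (geo9Y (f j)).len a ^ 2 * Real.exp (-(δ * (geo9Y (f j)).dist a a')) := fun a a' => by ring
  exact ⟨h1, h2, hasMajorant_mono (g := toB6 (geo9Y (f j)) 1 (H₀ (f j))) _ h3 fun a a' => le_of_eq (he a a'),
    hasMajorant_mono (g := toB6 (geo9Y (f j)) 1 (H₀ (f j))) _ h4 fun a a' => le_of_eq (he a a')⟩

end Family

end Literature.MathematicalPhysics.QuantumFieldTheory.Balaban1983to89.B9Eq3132FromStateRJ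

end
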